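import Mathlib
import Summits.HodgeConjecture.FermatCycles.HodgeFermatDecodingC

/-!
# THEOREM U, EQUALITY FORM: two all-unit triples of the same CM type COINCIDE (`HodgeFermat/TheoremUEq.lean`; HF-G27)

Tree copy (whole module) of the module `HodgeFermat/TheoremUEq.lean` of the sibling cell's standalone package
`run/shared/lean/pub/pub-hodgefermat/lean/HodgeFermat/` (271 lines, sha256 `49d81901776259cc…`), source lines 30–271 (all: `Perm3`, `ShareAt`, `EqAt`, `ThmUPlus′`, `ThmUEq`, `ThmUEqMultiset`; `eqAt_of_shareAt`; `thmUEq_of_thmUPlus′` and the multiset form).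
Filed by cell `pub-hfermat`, seat prover-1 gen-3, on the COORDINATOR KEEPER RULING of 2026-08-25 (gem sweep H1: take the
off-gate kernel theorem `thmFstar` through the gate) — here THEOREM F* of `tables/DPRIME-THEOREM.md` §9 IN FULL, i.e.
PROPOSITION D′(3N) and the descent (`HodgeFermat/PropDPrimeNFinal.lean`, GATE HF-G34), the last off-gate form of THEOREM F*
(its first two forms, `DecodingFinal.thmFstar` = F* at the prime levels and `ThmFstarNFinal.thmFstar` = F*(3N), landed on
2026-08-25 as `HodgeFermatThmFstar.lean` / `HodgeFermatThmFstarN.lean`, seats prover-1 gen-0 / gen-2); this file is one link of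
the import closure of `PropDPrimeNFinal.propDprime` (the sibling's KR-free chain: THEOREM L, COROLLARY M, THEOREM D6,
THEOREM U⁺, THEOREM KR6, THEOREM Z3U) on top of those landed chains.  The source module is the sibling's hub-checked module of
record (pub-hodgefermat `CERT.md` l.912, GATE HF-G27; cell record `check/TheoremUEq_standalone.lean` sha256 `676448e89d3fa777…`); its declarations are copied VERBATIM.
Deviations from the source module, exhaustively: the `import` lines (tree modules `Summits.HodgeConjecture.FermatCycles.
HodgeFermat*` instead of `HodgeFermat.*`); this module docstring; DEDUP (pre-empting the gate's `dedup.landed`): the source's `lemma sameType_symm` (l.92–93) restates the landed `HodgeFermat.KRFree.Decoding.st_symm` (`HodgeFermatDecodingC.lean`) VERBATIM and is therefore DELETED, its use (source l.194) resolving to the landed lemma through the added line `open HodgeFermat.KRFree.Decoding renaming st_symm → sameType_symm` (extra import); one-line docstrings added (gate lint) to `sameType_swap`, `rsum_rot`, `sameType_rot`, `shareAt_of_thmUPlus'`, `Perm3.map`, `thmUEqMultiset_of`.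
Every other line — in particular every declaration's statement and proof — is byte-identical to the source.
HONEST FRAMING: explicit algebraic cycles for specific Hodge classes on Fermat/Delsarte varieties; residual open instances
listed; no claim on general Hodge.  (This file is arithmetic of CM types / finite combinatorics / analytic number theory
of the sibling's KR-free programme; it claims nothing about cycles.)

The source module's docstring (TheoremUEq.lean l.6–28), verbatim:

## THEOREM U, EQUALITY FORM: two all-unit triples of the same CM type COINCIDE (HF-G27)

Generation 26 put THEOREM U⁺ in the kernel in its "share an entry" form (`HypUPlus.ThmUPlus`,
`TheoremUPlusFinal.thmUPlus`): at every odd level `N ∉ {21, 39}`, two triples `T = (a, b, c)`, `T' = (a', b', c')`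
of units mod `N` with `N ∣ a + b + c`, `N ∣ a' + b' + c'` and the same CM type
(`H_T ∩ (ℤ/N)ˣ = H_{T'} ∩ (ℤ/N)ˣ`, `LemmaN.SameType`) have `a ≡ a'`, `a ≡ b'` or `a ≡ c'`.
THIS module upgrades it, by pure combinatorics, to the statement of `tables/SEMI-THEOREM.md` §2 THEOREM U:
**`T'` is a permutation of `T` as residues mod `N`** (`EqAt`, `ThmUEq`, and the multiset form
`{a, b, c} = {a', b', c'}` in `ℤ/N`, `ThmUEqMultiset`).

The argument (`eqAt_of_shareAt`): the CM type of `(a, b, c)` is that of `(b, a, c)` (trivially) and of `(a', b', c')`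
(symmetry), so "share an entry" applied four times gives `a, b ∈ {a', b', c'}` and `a', b' ∈ {a, b, c}` mod `N`;
the residue sums `⟨a⟩ + ⟨b⟩ + ⟨c⟩`, `⟨a'⟩ + ⟨b'⟩ + ⟨c'⟩` both lie in `{N, 2N}` (`LemmaN.rsum_cases`), and two
such triples of residues `< N` with these four memberships are permutations of each other (`perm3_of_mem`:
the only failure mode `{x, x, y}` versus `{x, y, y}` has residue sums differing by `x - y`, `0 < |x - y| < N`).

LIGHT module: imports `LemmaN` only.  The hypothesis is carried as `ThmUPlus'`, a VERBATIM copy of the body of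
`HypUPlus.ThmUPlus` (so that the analytic chain is not imported here); `TheoremUEqFinal.lean` checks
`ThmUPlus' ↔ ThmUPlus` by `Iff.rfl` and feeds generation 26's `thmUPlus`.  Hub records: `check/TheoremUEq_standalone.lean`
(this file after `LemmaN`; `--axioms HodgeFermat.KRFree.TheoremUEq.thmUEq_of_thmUPlus'` = the three) and the link check
`check/ThmUEqLink_standalone.lean`.  Paper §1 (xiv); `tables/SEMI-THEOREM.md` §2.
-/

set_option autoImplicit false

namespace HodgeFermat.KRFree.TheoremUEq

open HodgeFermat.KRFree.LemmaN

open HodgeFermat.KRFree.Decoding renaming st_symm → sameType_symm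

/-! ## Statements -/

/-- `(A, B, C)` is a permutation of `(A', B', C')` (the six cases spelled out). -/
def Perm3 {α : Type*} (A B C A' B' C' : α) : Prop :=
  (A = A' ∧ B = B' ∧ C = C') ∨ (A = A' ∧ B = C' ∧ C = B') ∨
  (A = B' ∧ B = A' ∧ C = C') ∨ (A = B' ∧ B = C' ∧ C = A') ∨
  (A = C' ∧ B = A' ∧ C = B') ∨ (A = C' ∧ B = B' ∧ C = A')

/-- THEOREM U⁺ at ONE level `N` in its "share an entry" form: the conclusion of `HypUPlus.ThmUPlus` at `N`. -/
def ShareAt (N : ℕ) : Prop :=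
  ∀ a b c a' b' c' : ℕ,
    N ∣ a + b + c → N ∣ a' + b' + c' →
    Nat.Coprime a N → Nat.Coprime b N → Nat.Coprime c N →
    Nat.Coprime a' N → Nat.Coprime b' N → Nat.Coprime c' N →
    SameType N (a, b, c) (a', b', c') → (a ≡ a' [MOD N] ∨ a ≡ b' [MOD N] ∨ a ≡ c' [MOD N])

/-- THEOREM U at ONE level `N` in its EQUALITY form: two all-unit triples of level `N` with the same CM type are
permutations of each other as residues mod `N`. -/
def EqAt (N : ℕ) : Prop :=
  ∀ a b c a' b' c' : ℕ,
    N ∣ a + b + c → N ∣ a' + b' + c' →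
    Nat.Coprime a N → Nat.Coprime b N → Nat.Coprime c N →
    Nat.Coprime a' N → Nat.Coprime b' N → Nat.Coprime c' N →
    SameType N (a, b, c) (a', b', c') → Perm3 (a % N) (b % N) (c % N) (a' % N) (b' % N) (c' % N)

/-- VERBATIM copy of the body of `HodgeFermat.KRFree.HypUPlus.ThmUPlus` (`TheoremUPlus.lean`, generation 26) — restated
so that this module stays light; `TheoremUEqFinal.thmUPlus'_iff : ThmUPlus' ↔ ThmUPlus` is `Iff.rfl`. -/
def ThmUPlus' : Prop :=
  ∀ N a b c a' b' c' : ℕ, ¬ 2 ∣ N → N ≠ 21 → N ≠ 39 →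
    N ∣ a + b + c → N ∣ a' + b' + c' →
    Nat.Coprime a N → Nat.Coprime b N → Nat.Coprime c N →
    Nat.Coprime a' N → Nat.Coprime b' N → Nat.Coprime c' N →
    SameType N (a, b, c) (a', b', c') → (a ≡ a' [MOD N] ∨ a ≡ b' [MOD N] ∨ a ≡ c' [MOD N])

/-- **THEOREM U⁼** (`tables/SEMI-THEOREM.md` §2 THEOREM U, the form "T′ is a permutation of T"): at every ODD level
`N ∉ {21, 39}`, two triples of units mod `N` with zero sum and the same CM type coincide as unordered triples of
residues mod `N`. -/
def ThmUEq : Prop :=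
  ∀ N a b c a' b' c' : ℕ, ¬ 2 ∣ N → N ≠ 21 → N ≠ 39 →
    N ∣ a + b + c → N ∣ a' + b' + c' →
    Nat.Coprime a N → Nat.Coprime b N → Nat.Coprime c N →
    Nat.Coprime a' N → Nat.Coprime b' N → Nat.Coprime c' N →
    SameType N (a, b, c) (a', b', c') → Perm3 (a % N) (b % N) (c % N) (a' % N) (b' % N) (c' % N)

/-- THEOREM U⁼ as an equality of MULTISETS in `ℤ/N`: `{a, b, c} = {a', b', c'}`. -/
def ThmUEqMultiset : Prop :=
  ∀ N a b c a' b' c' : ℕ, ¬ 2 ∣ N → N ≠ 21 → N ≠ 39 →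
    N ∣ a + b + c → N ∣ a' + b' + c' →
    Nat.Coprime a N → Nat.Coprime b N → Nat.Coprime c N →
    Nat.Coprime a' N → Nat.Coprime b' N → Nat.Coprime c' N →
    SameType N (a, b, c) (a', b', c') →
    ({(a : ZMod N), (b : ZMod N), (c : ZMod N)} : Multiset (ZMod N)) =
      {(a' : ZMod N), (b' : ZMod N), (c' : ZMod N)}

/-! ## Symmetries of the CM type -/

/-- `H_{(a, b, c)} = H_{(b, a, c)}` on the nose. -/
lemma inH_swap (N a b c t : ℕ) : InH N (a, b, c) t ↔ InH N (b, a, c) t := by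
  show t * a % N + t * b % N < N ↔ t * b % N + t * a % N < N
  omega

/-- swapping the first two entries of the left triple preserves `SameType` -/
lemma sameType_swap {N a b c : ℕ} {T' : ℕ × ℕ × ℕ} (h : SameType N (a, b, c) T') :
    SameType N (b, a, c) T' :=
  fun t ht => (inH_swap N a b c t).symm.trans (h t ht)

/-- a unit is not a multiple of `N > 1` -/
lemma not_dvd_unit {N x : ℕ} (h1 : 1 < N) (hx : Nat.Coprime x N) : ¬ N ∣ x := fun hd =>
  absurd (Nat.Coprime.eq_one_of_dvd hx.symm hd) (by omega)

/-- the product of two units is not a multiple of `N > 1` -/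
lemma not_dvd_mul_unit {N t x : ℕ} (h1 : 1 < N) (ht : Nat.Coprime t N) (hx : Nat.Coprime x N) :
    ¬ N ∣ t * x :=
  not_dvd_unit h1 (Nat.coprime_mul_iff_left.mpr ⟨ht, hx⟩)

/-- `rsum` is invariant under rotating the entries -/
lemma rsum_rot (N a b c t : ℕ) : rsum N (b, c, a) t = rsum N (a, b, c) t := by
  show t * b % N + t * c % N + t * a % N = t * a % N + t * b % N + t * c % N
  omega

/-- `H_{(a, b, c)} ∩ units = H_{(b, c, a)} ∩ units` when `N ∣ a + b + c` and `a`, `c` are units: at a unit `t` both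
memberships say "the residue sum `⟨ta⟩ + ⟨tb⟩ + ⟨tc⟩` is `N`" (`LemmaN.rsum_cases`). -/
lemma inH_rot {N a b c t : ℕ} (h1 : 1 < N) (hs : N ∣ a + b + c) (ha : Nat.Coprime a N)
    (hc : Nat.Coprime c N) (ht : Nat.Coprime t N) : InH N (a, b, c) t ↔ InH N (b, c, a) t := by
  have hN : 0 < N := by omega
  have hs' : N ∣ b + c + a := by
    have e : b + c + a = a + b + c := by omega
    rw [e]; exact hs
  obtain ⟨-, hab⟩ := rsum_cases (x := a) (y := b) hN hs (not_dvd_mul_unit h1 ht hc)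
  obtain ⟨-, hbc⟩ := rsum_cases (x := b) (y := c) hN hs' (not_dvd_mul_unit h1 ht ha)
  rw [hab, hbc, rsum_rot N a b c t]

/-- rotating an all-unit zero-sum triple preserves `SameType` -/
lemma sameType_rot {N a b c : ℕ} {T' : ℕ × ℕ × ℕ} (h1 : 1 < N) (hs : N ∣ a + b + c)
    (ha : Nat.Coprime a N) (hc : Nat.Coprime c N) (h : SameType N (a, b, c) T') :
    SameType N (b, c, a) T' :=
  fun t ht => (inH_rot h1 hs ha hc ht).symm.trans (h t ht)

/-- the residues of a zero-sum triple with a unit third entry sum to `N` or `2N` -/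
lemma residue_sum {N a b c : ℕ} (h1 : 1 < N) (hs : N ∣ a + b + c) (hc : Nat.Coprime c N) :
    a % N + b % N + c % N = N ∨ a % N + b % N + c % N = 2 * N := by
  have hN : 0 < N := by omega
  have h1c : ¬ N ∣ 1 * c := by rw [Nat.one_mul]; exact not_dvd_unit h1 hc
  have h := (rsum_cases (x := a) (y := b) (t := 1) hN hs h1c).1
  simpa [rsum] using h

/-! ## The combinatorial lemma -/

/-- Two residue triples `(A, B, C)`, `(A, B', C')` with a COMMON first entry, all entries `< N`, both residue sums in
`{N, 2N}`, `B ∈ {A, B', C'}` and `B' ∈ {A, B, C}`: then `{B, C} = {B', C'}`.  (Each leaf: the two sums differ by the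
difference of two residues, which is `< N` in absolute value, hence `0`.) -/
lemma pair_of_mem {N A B C B' C' : ℕ} (hA : A < N) (hB : B < N) (hC : C < N) (hB' : B' < N) (hC' : C' < N)
    (hS : A + B + C = N ∨ A + B + C = 2 * N) (hS' : A + B' + C' = N ∨ A + B' + C' = 2 * N)
    (mb : B = A ∨ B = B' ∨ B = C') (mb' : B' = A ∨ B' = B ∨ B' = C) :
    (B = B' ∧ C = C') ∨ (B = C' ∧ C = B') := by
  rcases mb with h | h | h
  · rcases mb' with h' | h' | h'
    · left; constructor <;> omega
    · left; constructor <;> omega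
    · right; constructor <;> omega
  · left; constructor <;> omega
  · right; constructor <;> omega

/-- **Two residue triples which see each other's first two entries are permutations of each other.**
`A, B, C, A', B', C' < N`, both residue sums in `{N, 2N}`, `A, B ∈ {A', B', C'}` and `A', B' ∈ {A, B, C}` imply that
`(A, B, C)` is a permutation of `(A', B', C')`. -/
theorem perm3_of_mem {N A B C A' B' C' : ℕ} (hA : A < N) (hB : B < N) (hC : C < N) (hA' : A' < N)
    (hB' : B' < N) (hC' : C' < N)
    (hS : A + B + C = N ∨ A + B + C = 2 * N) (hS' : A' + B' + C' = N ∨ A' + B' + C' = 2 * N)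
    (ma : A = A' ∨ A = B' ∨ A = C') (mb : B = A' ∨ B = B' ∨ B = C')
    (ma' : A' = A ∨ A' = B ∨ A' = C) (mb' : B' = A ∨ B' = B ∨ B' = C) :
    Perm3 A B C A' B' C' := by
  rcases ma with h | h | h
  · -- `A = A'`
    have hS₂ : A + B' + C' = N ∨ A + B' + C' = 2 * N := by omega
    rcases pair_of_mem hA hB hC hB' hC' hS hS₂ (by omega) (by omega) with ⟨h2, h3⟩ | ⟨h2, h3⟩
    · exact Or.inl ⟨h, h2, h3⟩
    · exact Or.inr (Or.inl ⟨h, h2, h3⟩)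
  · -- `A = B'`: read `T'` as `(B', A', C')`
    have hS₂ : A + A' + C' = N ∨ A + A' + C' = 2 * N := by omega
    rcases pair_of_mem hA hB hC hA' hC' hS hS₂ (by omega) (by omega) with ⟨h2, h3⟩ | ⟨h2, h3⟩
    · exact Or.inr (Or.inr (Or.inl ⟨h, h2, h3⟩))
    · exact Or.inr (Or.inr (Or.inr (Or.inl ⟨h, h2, h3⟩)))
  · -- `A = C'`: read `T'` as `(C', B', A')`
    have hS₂ : A + B' + A' = N ∨ A + B' + A' = 2 * N := by omega
    rcases pair_of_mem hA hB hC hB' hA' hS hS₂ (by omega) (by omega) with ⟨h2, h3⟩ | ⟨h2, h3⟩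
    · exact Or.inr (Or.inr (Or.inr (Or.inr (Or.inr ⟨h, h2, h3⟩))))
    · exact Or.inr (Or.inr (Or.inr (Or.inr (Or.inl ⟨h, h2, h3⟩))))

/-! ## THEOREM U⁼ from THEOREM U⁺ -/

/-- **"share an entry" ⟹ "coincide"** at every level `N`. -/
theorem eqAt_of_shareAt {N : ℕ} (hsh : ShareAt N) : EqAt N := by
  intro a b c a' b' c' hs hs' ha hb hc ha' hb' hc' hT
  rcases Nat.lt_or_ge 1 N with h1 | hN1
  · have hN : 0 < N := by omega
    have hsb : N ∣ b + a + c := by rwa [Nat.add_comm b a]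
    have hsb' : N ∣ b' + a' + c' := by rwa [Nat.add_comm b' a']
    have hT' : SameType N (a', b', c') (a, b, c) := sameType_symm hT
    have ma : a % N = a' % N ∨ a % N = b' % N ∨ a % N = c' % N :=
      hsh a b c a' b' c' hs hs' ha hb hc ha' hb' hc' hT
    have mb : b % N = a' % N ∨ b % N = b' % N ∨ b % N = c' % N :=
      hsh b a c a' b' c' hsb hs' hb ha hc ha' hb' hc' (sameType_swap hT)
    have ma' : a' % N = a % N ∨ a' % N = b % N ∨ a' % N = c % N :=
      hsh a' b' c' a b c hs' hs ha' hb' hc' ha hb hc hT'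
    have mb' : b' % N = a % N ∨ b' % N = b % N ∨ b' % N = c % N :=
      hsh b' a' c' a b c hsb' hs hb' ha' hc' ha hb hc (sameType_swap hT')
    exact perm3_of_mem (Nat.mod_lt a hN) (Nat.mod_lt b hN) (Nat.mod_lt c hN) (Nat.mod_lt a' hN)
      (Nat.mod_lt b' hN) (Nat.mod_lt c' hN) (residue_sum h1 hs hc) (residue_sum h1 hs' hc') ma mb ma' mb'
  · -- degenerate levels: `N = 0` is excluded by the unit hypotheses, at `N = 1` every residue is `0`
    interval_cases N
    · have h0 : a + b + c = 0 := Nat.eq_zero_of_zero_dvd hs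
      have ha1 : a = 1 := by simpa using ha
      omega
    · exact Or.inl ⟨by simp [Nat.mod_one], by simp [Nat.mod_one], by simp [Nat.mod_one]⟩

/-- `ThmUPlus′` specialised to one admissible level gives `ShareAt N` -/
theorem shareAt_of_thmUPlus' (h : ThmUPlus') (N : ℕ) (h2 : ¬ 2 ∣ N) (h21 : N ≠ 21) (h39 : N ≠ 39) :
    ShareAt N :=
  fun a b c a' b' c' => h N a b c a' b' c' h2 h21 h39

/-- **THEOREM U⁼ from THEOREM U⁺** (the hub-checked content of this module). -/
theorem thmUEq_of_thmUPlus' (h : ThmUPlus') : ThmUEq :=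
  fun N a b c a' b' c' h2 h21 h39 => eqAt_of_shareAt (shareAt_of_thmUPlus' h N h2 h21 h39) a b c a' b' c'

/-- conversely the equality form trivially gives back "share an entry". -/
theorem thmUPlus'_of_thmUEq (h : ThmUEq) : ThmUPlus' := by
  intro N a b c a' b' c' h2 h21 h39 hs hs' ha hb hc ha' hb' hc' hT
  rcases h N a b c a' b' c' h2 h21 h39 hs hs' ha hb hc ha' hb' hc' hT with
    ⟨e, -, -⟩ | ⟨e, -, -⟩ | ⟨e, -, -⟩ | ⟨e, -, -⟩ | ⟨e, -, -⟩ | ⟨e, -, -⟩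
  · exact Or.inl e
  · exact Or.inl e
  · exact Or.inr (Or.inl e)
  · exact Or.inr (Or.inl e)
  · exact Or.inr (Or.inr e)
  · exact Or.inr (Or.inr e)

/-! ## The multiset form in `ℤ/N` -/

/-- `Perm3` is preserved by applying a function to all six entries -/
lemma Perm3.map {α β : Type*} (f : α → β) {A B C A' B' C' : α} (h : Perm3 A B C A' B' C') :
    Perm3 (f A) (f B) (f C) (f A') (f B') (f C') := by
  rcases h with ⟨rfl, rfl, rfl⟩ | ⟨rfl, rfl, rfl⟩ | ⟨rfl, rfl, rfl⟩ | ⟨rfl, rfl, rfl⟩ |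
    ⟨rfl, rfl, rfl⟩ | ⟨rfl, rfl, rfl⟩ <;> simp [Perm3]

/-- a permutation of a triple has the same multiset -/
theorem multiset_eq_of_perm3 {α : Type*} {A B C A' B' C' : α} (h : Perm3 A B C A' B' C') :
    ({A, B, C} : Multiset α) = {A', B', C'} := by
  rcases h with ⟨h1, h2, h3⟩ | ⟨h1, h2, h3⟩ | ⟨h1, h2, h3⟩ | ⟨h1, h2, h3⟩ | ⟨h1, h2, h3⟩ | ⟨h1, h2, h3⟩ <;>
    rw [h1, h2, h3]
  · rw [Multiset.pair_comm C' B']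
  · exact Multiset.cons_swap B' A' {C'}
  · rw [Multiset.pair_comm C' A']
    exact Multiset.cons_swap B' A' {C'}
  · rw [show ({C', A', B'} : Multiset α) = {A', C', B'} from Multiset.cons_swap C' A' {B'},
      Multiset.pair_comm C' B']
  · rw [Multiset.pair_comm B' A',
      show ({C', A', B'} : Multiset α) = {A', C', B'} from Multiset.cons_swap C' A' {B'},
      Multiset.pair_comm C' B']

/-- residues mod `N` which agree as a permuted triple give equal multisets `{a, b, c} = {a', b', c'}` in `ℤ/N` -/
theorem zmod_multiset_eq {N a b c a' b' c' : ℕ}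
    (h : Perm3 (a % N) (b % N) (c % N) (a' % N) (b' % N) (c' % N)) :
    ({(a : ZMod N), (b : ZMod N), (c : ZMod N)} : Multiset (ZMod N)) =
      {(a' : ZMod N), (b' : ZMod N), (c' : ZMod N)} := by
  have h' := h.map (fun x : ℕ => (x : ZMod N))
  simp only [ZMod.natCast_mod] at h'
  exact multiset_eq_of_perm3 h'

/-- the multiset form of THEOREM U⁼ from `ThmUEq` -/
theorem thmUEqMultiset_of (h : ThmUEq) : ThmUEqMultiset :=
  fun N a b c a' b' c' h2 h21 h39 hs hs' ha hb hc ha' hb' hc' hT =>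
    zmod_multiset_eq (h N a b c a' b' c' h2 h21 h39 hs hs' ha hb hc ha' hb' hc' hT)

/-- THEOREM U⁼ in multiset form from THEOREM U⁺. -/
theorem thmUEqMultiset_of_thmUPlus' (h : ThmUPlus') : ThmUEqMultiset :=
  thmUEqMultiset_of (thmUEq_of_thmUPlus' h)

end HodgeFermat.KRFree.TheoremUEq
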